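import Literature.AlgebraicGeometry.Resolution.QuadraticTransformDelta
import Literature.AlgebraicGeometry.Resolution.CurveDeltaDrop
import Literature.AlgebraicGeometry.Resolution.CurveDeltaInvariant
import Literature.AlgebraicGeometry.Resolution.QuadraticTransforms
import Literature.AlgebraicGeometry.Resolution.QuadraticTransformsProofs
import Mathlib.RingTheory.KrullDimension.LocalRing
import HarnessLib

/-!
# Lineages of curve germs under point blow-ups become regular (D3c-α of the σ-residual LOW half, W4.1)

W4.1, crux `Steer` (stmt-ResolutionOfSingularities-16345), σ-line at `p = 2`, LOW half: res-L0-w41-idea-3 card 3 v3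
«hyperbolic-splitting-p2» piece **D3c = F5 TAMING** (res-L0-w41-plan-1 RULING 18d 2026-08-27T08:28:59Z: «D3c (F5 taming …,
M) → res-type-062»). F5 (iii) of the card: «`A_n/𝔮` is a reduced excellent one-dimensional local ring (finite normalisation), so
by Krull 1930 = Kollár 2007 Thm 1.101 its lineage is regular or has left the local ring after finitely many point steps». This
file is the RING-LEVEL ENGINE of that sentence in the LOW tower's own language (subrings of ONE field, quadratic transforms —
`Literature/…/QuadraticTransforms.lean`, `QuadraticTransformDelta.lean`), Theses-free and def-free:

* `curveGerm_quadraticTransform` — the class «one-dimensional Noetherian local domain of `κ` with fraction field `κ` and finite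
  normalisation» is stable under quadratic transforms (Krull–Akizuki + `S̄ = S[D̄]`, all from the tree);
* `toNat_curveDelta_lt_of_quadraticTransform` — at a NON-regular germ the `δ`-invariant drops strictly under a quadratic
  transform (`IsQuadraticTransform.curveDelta_lt`, Kollár §1.4 / Krull 1930, PROVED in the tree), as natural numbers;
* `eq_of_quadraticTransform_of_isDiscreteValuationRing` — a regular germ (DVR) has no proper quadratic transform;
* `eventually_isDiscreteValuationRing_of_lineage` — **THE LINEAGE THEOREM**: along a chain `D 0, D 1, …` of subrings of `κ` in
  which every step is the identity (the blown-up point misses the curve's data / a curve step) or a quadratic transform (a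
  point step through the curve), with infinitely many quadratic-transform steps and `D 0` in the class, EVENTUALLY EVERY
  MEMBER IS A DISCRETE VALUATION RING (the lineage of the curve germ is regular from some stage on);
* `eventually_isRegularLocalRing_of_lineage` — the same with `IsRegularLocalRing`.

Consumer: D3c-β (the finite set of bad-curve lineages of the LOW tower is never enlarged — F5 (i)/(ii) — hence eventually
empty) over res-L0-w41-stub-4's D3a tower vocabulary, binders per res-L0-w41-idea-3's §σ2.23 Props. No Theses file of W4.1 is
imported; nothing here is a route item. OURS (the W4.1 engine), standard commutative algebra; NOT a statement of the manuscript
under review [claim: Hironaka2017, status: under-review]. [cite: Kollar2007, §1.4, Thm. 1.101] [cite: Cutkosky2014, §2.1]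
-/

noncomputable section

-- `Summit.<S>.<S>.…` duplicates the summit name by design (single-problem summit).
set_option linter.dupNamespace false

open IsLocalRing Literature.AlgebraicGeometry.Resolution

namespace Summit.ResolutionOfSingularities.ResolutionOfSingularities.Theorems.SwitchingDichotomy.CurveLineage

variable {K : Type} [Field K]

/-! ## §1 One step -/

/-- **The class of curve germs is stable under quadratic transforms**: if `D ⊆ κ` is a local ring OF `κ` (`QF(D) = κ`),
Noetherian of Krull dimension `1` with module-finite normalisation, then so is every quadratic transform `S` of `D`
(Krull–Akizuki; `S̄ = S[D̄]`). [cite: Kollar2007, §1.4] -/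
theorem curveGerm_quadraticTransform {D S : Subring K} (hof : IsLocalRingOf D) (hN : IsNoetherianRing D)
    (hdim : ringKrullDim D = 1) (hfin : Module.Finite D (integralClosure D K))
    (h : IsQuadraticTransform D S) :
    IsLocalRingOf S ∧ IsNoetherianRing S ∧ ringKrullDim S = 1 ∧ Module.Finite S (integralClosure S K) := by
  haveI : IsLocalRing D := hof.1
  haveI := hN
  haveI := hfin
  haveI : IsFractionRing D K := isFractionRing_of_isLocalRingOf_le hof.2 le_rfl
  have hD : ¬ IsField D := (ringKrullDim_eq_one_iff_of_isLocalRing_isDomain.mp hdim).1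
  haveI : IsDedekindDomain (integralClosure D K) :=
    isDedekindDomain_integralClosure_of_module_finite D K hdim.le
  refine ⟨⟨h.isLocalRing, fun z => ?_⟩, h.isNoetherianRing hof hD hdim, h.ringKrullDim_eq_one hof hD hdim,
    h.module_finite_integralClosure hof⟩
  obtain ⟨a, ha, b, hb, hb0, rfl⟩ := hof.2 z
  exact ⟨a, h.le' ha, b, h.le' hb, hb0, rfl⟩

/-- `δ < ∞` for a curve germ, so `δ = ↑(δ.toNat)`. [cite: Kollar2007, §1.4] -/
theorem coe_toNat_curveDelta {D : Subring K} (hof : IsLocalRingOf D) (hN : IsNoetherianRing D)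
    (hdim : ringKrullDim D = 1) (hfin : Module.Finite D (integralClosure D K)) :
    ((curveDelta D K).toNat : ℕ∞) = curveDelta D K := by
  haveI : IsLocalRing D := hof.1
  haveI := hN
  haveI := hfin
  haveI : IsFractionRing D K := isFractionRing_of_isLocalRingOf_le hof.2 le_rfl
  exact ENat.coe_toNat (curveDelta_ne_top K hdim)

/-- **`δ` drops strictly under a quadratic transform of a NON-regular curve germ** (as natural numbers).
[cite: Kollar2007, §1.4, Thm. 1.101] -/
theorem toNat_curveDelta_lt_of_quadraticTransform {D S : Subring K} (hof : IsLocalRingOf D)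
    (hN : IsNoetherianRing D) (hdim : ringKrullDim D = 1) (hfin : Module.Finite D (integralClosure D K))
    (hreg : ¬ IsDiscreteValuationRing D) (h : IsQuadraticTransform D S) :
    (curveDelta S K).toNat < (curveDelta D K).toNat := by
  haveI : IsLocalRing D := hof.1
  haveI := hN
  haveI := hfin
  haveI : IsFractionRing D K := isFractionRing_of_isLocalRingOf_le hof.2 le_rfl
  have hD : ¬ IsField D := (ringKrullDim_eq_one_iff_of_isLocalRing_isDomain.mp hdim).1
  haveI : IsDedekindDomain (integralClosure D K) :=
    isDedekindDomain_integralClosure_of_module_finite D K hdim.le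
  haveI : IsFractionRing (integralClosure D K) K := isFractionRing_integralClosure D K
  haveI : IsFractionRing S K := isFractionRing_of_isLocalRingOf_le hof.2 h.le'
  have hlt := IsQuadraticTransform.curveDelta_lt hof hD hdim hreg h
  obtain ⟨hofS, hNS, hdimS, hfinS⟩ := curveGerm_quadraticTransform hof hN hdim hfin h
  have h1 := coe_toNat_curveDelta hof hN hdim hfin
  have h2 := coe_toNat_curveDelta hofS hNS hdimS hfinS
  rw [← h1, ← h2] at hlt
  exact_mod_cast hlt

/-- **`δ` does not increase under a quadratic transform** (as natural numbers; a regular germ is its own transform).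
[cite: Kollar2007, §1.4] -/
theorem toNat_curveDelta_le_of_quadraticTransform {D S : Subring K} (hof : IsLocalRingOf D)
    (hN : IsNoetherianRing D) (hdim : ringKrullDim D = 1) (hfin : Module.Finite D (integralClosure D K))
    (h : IsQuadraticTransform D S) :
    (curveDelta S K).toNat ≤ (curveDelta D K).toNat := by
  by_cases hreg : IsDiscreteValuationRing D
  · rw [h.eq_self_of_isDiscreteValuationRing]
  · exact (toNat_curveDelta_lt_of_quadraticTransform hof hN hdim hfin hreg h).le

/-- A regular curve germ (a DVR) has no proper quadratic transform. [cite: Kollar2007, Lemma 1.99] -/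
theorem eq_of_quadraticTransform_of_isDiscreteValuationRing {D S : Subring K} (hD : IsDiscreteValuationRing D)
    (h : IsQuadraticTransform D S) : S = D :=
  h.eq_self_of_isDiscreteValuationRing

/-! ## §2 The lineage theorem -/

/-- **Lineages of curve germs under point blow-ups become regular.** Let `D : ℕ → Subring κ` be a chain in which every
step is the identity or a quadratic transform, with infinitely many quadratic-transform steps, and `D 0` a one-dimensional
Noetherian local domain of `κ` (`QF = κ`) with module-finite normalisation. Then from some stage on every `D n` is a
discrete valuation ring: `δ(D n) ∈ ℕ` never increases, drops strictly at every quadratic transform of a non-regular member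
(Kollár §1.4 / Krull 1930), so some member is a DVR, and a DVR is its own quadratic transform. (F5 (iii) of res-L0-w41-idea-3's
card 3 v3, ring level.) [cite: Kollar2007, §1.4, Thm. 1.101] -/
theorem eventually_isDiscreteValuationRing_of_lineage (D : ℕ → Subring K)
    (hof : IsLocalRingOf (D 0)) (hN : IsNoetherianRing (D 0)) (hdim : ringKrullDim (D 0) = 1)
    (hfin : Module.Finite (D 0) (integralClosure (D 0) K))
    (hstep : ∀ n, D (n + 1) = D n ∨ IsQuadraticTransform (D n) (D (n + 1)))
    (hinf : ∀ n₀, ∃ n, n₀ ≤ n ∧ IsQuadraticTransform (D n) (D (n + 1))) :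
    ∃ n₀, ∀ n, n₀ ≤ n → IsDiscreteValuationRing (D n) := by
  classical
  -- the class is inherited along the chain
  have hinv : ∀ n, IsLocalRingOf (D n) ∧ IsNoetherianRing (D n) ∧ ringKrullDim (D n) = 1 ∧
      Module.Finite (D n) (integralClosure (D n) K) := by
    intro n
    induction n with
    | zero => exact ⟨hof, hN, hdim, hfin⟩
    | succ n ih =>
      rcases hstep n with h | h
      · rw [h]; exact ih
      · exact curveGerm_quadraticTransform ih.1 ih.2.1 ih.2.2.1 ih.2.2.2 h
  -- `δ` as a natural number: monotone, strictly decreasing at quadratic transforms of non-regular members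
  set δ : ℕ → ℕ := fun n => (curveDelta (D n) K).toNat with hδ
  have hmono : ∀ n, δ (n + 1) ≤ δ n := by
    intro n
    rcases hstep n with h | h
    · simp only [hδ]; rw [h]
    · exact toNat_curveDelta_le_of_quadraticTransform (hinv n).1 (hinv n).2.1 (hinv n).2.2.1 (hinv n).2.2.2 h
  have hanti : Antitone δ := antitone_nat_of_succ_le hmono
  have hstrict : ∀ n, IsQuadraticTransform (D n) (D (n + 1)) → ¬ IsDiscreteValuationRing (D n) →
      δ (n + 1) < δ n := fun n h hreg =>
    toNat_curveDelta_lt_of_quadraticTransform (hinv n).1 (hinv n).2.1 (hinv n).2.2.1 (hinv n).2.2.2 hreg h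
  -- some member is a DVR
  have hex : ∃ n, IsDiscreteValuationRing (D n) := by
    by_contra hcon
    push Not at hcon
    have key : ∀ k : ℕ, ∃ n, δ n + k ≤ δ 0 := by
      intro k
      induction k with
      | zero => exact ⟨0, by simp⟩
      | succ k ih =>
        obtain ⟨n, hn⟩ := ih
        obtain ⟨m, hnm, hqt⟩ := hinf n
        refine ⟨m + 1, ?_⟩
        have h1 := hstrict m hqt (hcon m)
        have h2 := hanti hnm
        omega
    obtain ⟨n, hn⟩ := key (δ 0 + 1)
    omega
  obtain ⟨n₀, hn₀⟩ := hex
  -- a DVR is absorbing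
  refine ⟨n₀, fun n hn => ?_⟩
  induction n, hn using Nat.le_induction with
  | base => exact hn₀
  | succ m _ ih =>
    have heq : D (m + 1) = D m := by
      rcases hstep m with h | h
      · exact h
      · exact eq_of_quadraticTransform_of_isDiscreteValuationRing ih h
    rw [heq]
    exact ih

/-- **Lineages of curve germs under point blow-ups become regular** (`IsRegularLocalRing` form of
`eventually_isDiscreteValuationRing_of_lineage`). [cite: Kollar2007, §1.4, Thm. 1.101] -/
theorem eventually_isRegularLocalRing_of_lineage (D : ℕ → Subring K)
    (hof : IsLocalRingOf (D 0)) (hN : IsNoetherianRing (D 0)) (hdim : ringKrullDim (D 0) = 1)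
    (hfin : Module.Finite (D 0) (integralClosure (D 0) K))
    (hstep : ∀ n, D (n + 1) = D n ∨ IsQuadraticTransform (D n) (D (n + 1)))
    (hinf : ∀ n₀, ∃ n, n₀ ≤ n ∧ IsQuadraticTransform (D n) (D (n + 1))) :
    ∃ n₀, ∀ n, n₀ ≤ n → IsRegularLocalRing (D n) := by
  obtain ⟨n₀, h⟩ := eventually_isDiscreteValuationRing_of_lineage D hof hN hdim hfin hstep hinf
  refine ⟨n₀, fun n hn => ?_⟩
  haveI := h n hn
  infer_instance

end Summit.ResolutionOfSingularities.ResolutionOfSingularities.Theorems.SwitchingDichotomy.CurveLineage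

end
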